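import Mathlib
import Summits.NavierStokesRegularity.NavierStokesRegularity.Theorems.EulerZoomLiouvillePowerGaugeEulerLiouvilleSelfSimilarSaddleContinuumPlane
import Literature.Analysis.FluidPDE.SelfSimilarEulerOutgoingFlatVorticity
import HarnessLib

/-!
# Rung C1 of the crux `EulerZoomLiouville.PowerGaugeEulerLiouville`: EVERY NON-VORTICAL BAD STAGNATION POINT IS THIN —
# the block hypothesis of the saddle-continuum exclusion is automatic at non-vortical bad nodes
# (route №10, item stmt-NavierStokesRegularity-19832; `--supports`)

Helper file (theorems only). Seat ns-typeII-p3 (cell ns-regularity-ideate §B, D-0081).  Sequel to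
`…SelfSimilarSaddleContinuumPlane` (`eq_zero_of_driftCoordinate_of_thinBlock_on_badSet`: drift coordinate on a
neighbourhood of `𝒩_W` + a thin real block form of either shape at EVERY BAD NODE ⇒ `V ≡ 0`).  At a NON-VORTICAL
stagnation point `z` (`curl V z = 0`) the linearisation `DW(z) = γI + DV(z)` is SYMMETRIC (tree
`isSymmetric_fderiv_of_curl_eq_zero`); by the spectral theorem (Mathlib `LinearMap.IsSymmetric.eigenvectorBasis`) it
has an orthonormal eigenbasis with real eigenvalues `λ₁ ≤ λ₂ ≤ λ₃`, `Σλᵢ = tr DW(z) = 3γ` (`div V = 0`).  If `z` is BAD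
(`⟪DV(z)w, w⟫ ≥ 1` for a unit `w`), then `λ₃ ≥ 1 + γ`, so `λ₁ + λ₂ ≤ 2γ − 1 < 0`; hence EITHER `λ₁ < λ₂` (a dominated
contracting LINE) OR `λ₁ = λ₂ < 0 < λ₃` (a dominated contracting PLANE).  So:

* **`exists_thinBlock_of_curl_eq_zero_of_bad`** — at every non-vortical bad node of a profile with `γ < ½` the thin
  block hypothesis holds (explicit `Module.Basis` from the eigenvectors, `β = 0`);
* **`eq_zero_of_driftCoordinate_of_thinBlock_on_vorticalBadSet`** — THE EXCLUSION THEOREM WITH THE BLOCK HYPOTHESIS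
  ONLY AT VORTICAL BAD NODES: `0 < γ < ½`, `V` smooth, (3.8), a `C¹` drift coordinate on an open `U ⊇ 𝒩_W` injective
  on `𝒩_W`, and a thin block form at every bad node with `curl V z ≠ 0` ⇒ `V ≡ 0`.  In particular, **if every bad
  stagnation point is non-vortical (e.g. all of `𝒩_W` lies in the irrotational region), a drift coordinate alone
  forces `V ≡ 0`** (`eq_zero_of_driftCoordinate_of_nonvortical_badNodes`).

WHAT THIS IS NOT: not NS, not E, not rung C1 — the drift coordinate remains a HYPOTHESIS; vortical bad nodes still need
block data (p2's invariant-plane analysis would supply it for semisimple linearisations).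
[folklore; cf. ConstantinIgnatovaVicol2026Putative §3.5 Thm 3.8 («in view of Ω(y*) = 0, ∇U(y*) = 𝕊»)]
-/

noncomputable section

-- flat `Theorems/<Route><Decl>…` files of one crux share the namespace of the crux (tree convention)
set_option linter.dupNamespace false

open MeasureTheory Set Filter Topology Metric Function InnerProductSpace
open scoped RealInnerProductSpace NNReal ContDiff

namespace Summit.NavierStokesRegularity.NavierStokesRegularity.Theorems.PowerGaugeEulerLiouville.Kelvin

open Literature.Analysis Literature.Analysis.FluidPDE Literature.Dynamics.FixedPoints

variable {γ : ℝ} {V : EuclideanSpace ℝ (Fin 3) → EuclideanSpace ℝ (Fin 3)} {P : EuclideanSpace ℝ (Fin 3) → ℝ}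

/-! ### Non-vortical bad nodes carry a thin block form -/

/-- Three distinct vectors of an orthonormal basis are linearly independent (in any order). [folklore] -/
theorem linearIndependent_orthonormalBasis_triple (e : OrthonormalBasis (Fin 3) ℝ (EuclideanSpace ℝ (Fin 3)))
    {i j k : Fin 3} (hij : i ≠ j) (hik : i ≠ k) (hjk : j ≠ k) :
    LinearIndependent ℝ ![e i, e j, e k] := by
  refine linearIndependent_of_ne_zero_of_inner_eq_zero (fun a => ?_) (fun a a' haa' => ?_)
  · have h1 : ‖(![e i, e j, e k] : Fin 3 → EuclideanSpace ℝ (Fin 3)) a‖ = 1 := by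
      fin_cases a <;> simp [e.orthonormal.1]
    intro h0
    rw [h0, norm_zero] at h1
    exact zero_ne_one h1
  · fin_cases a <;> fin_cases a' <;>
      simp_all [hij.symm, hik.symm, hjk.symm]

/-- **EVERY NON-VORTICAL BAD NODE IS THIN.**  Let `V` be differentiable at `z` with `div V = 0`, `γ < ½`,
`curl V z = 0` and `1 ≤ ⟪DV(z) w, w⟫` for some unit `w`.  Then `γI + DV(z)` has a real block form (from an
orthonormal eigenbasis, `β = 0`) with a dominated contracting line (`d₂ < 0`, `d₂ < d₀`, `d₂ < d₁`) or a dominated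
contracting plane (`d₀, d₁ < 0`, `d₀, d₁ < d₂`). [cite: ConstantinIgnatovaVicol2026Putative, §3.5 Thm 3.8 (the symmetric linearisation at a non-vortical node)] -/
theorem exists_thinBlock_of_curl_eq_zero_of_bad (hVd : Differentiable ℝ V) (hdiv : VectorCalculus.IsDivFree V)
    (hγ2 : γ < 1 / 2) {z : EuclideanSpace ℝ (Fin 3)} (hcurl : curl V z = 0)
    (hbad : ∃ w : EuclideanSpace ℝ (Fin 3), ‖w‖ = 1 ∧ 1 ≤ ⟪fderiv ℝ V z w, w⟫) :
    ∃ (b : Module.Basis (Fin 3) ℝ (EuclideanSpace ℝ (Fin 3))) (lam : Fin 3 → ℝ) (β : ℝ),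
      (γ • ContinuousLinearMap.id ℝ (EuclideanSpace ℝ (Fin 3)) + fderiv ℝ V z) (b 0) = lam 0 • b 0 - β • b 1 ∧
      (γ • ContinuousLinearMap.id ℝ (EuclideanSpace ℝ (Fin 3)) + fderiv ℝ V z) (b 1) = β • b 0 + lam 1 • b 1 ∧
      (γ • ContinuousLinearMap.id ℝ (EuclideanSpace ℝ (Fin 3)) + fderiv ℝ V z) (b 2) = lam 2 • b 2 ∧
      ((lam 2 < 0 ∧ lam 2 < lam 0 ∧ lam 2 < lam 1) ∨ (lam 0 < 0 ∧ lam 1 < 0 ∧ lam 0 < lam 2 ∧ lam 1 < lam 2)) := by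
  classical
  set A : EuclideanSpace ℝ (Fin 3) →L[ℝ] EuclideanSpace ℝ (Fin 3) :=
    γ • ContinuousLinearMap.id ℝ (EuclideanSpace ℝ (Fin 3)) + fderiv ℝ V z with hA
  -- `A` is symmetric
  have hDVsym := isSymmetric_fderiv_of_curl_eq_zero (hVd z) hcurl
  have hAsym : (A : EuclideanSpace ℝ (Fin 3) →ₗ[ℝ] EuclideanSpace ℝ (Fin 3)).IsSymmetric := by
    have h1 : ((γ • ContinuousLinearMap.id ℝ (EuclideanSpace ℝ (Fin 3)) : EuclideanSpace ℝ (Fin 3) →L[ℝ]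
        EuclideanSpace ℝ (Fin 3)) : EuclideanSpace ℝ (Fin 3) →ₗ[ℝ] EuclideanSpace ℝ (Fin 3)).IsSymmetric := by
      rw [ContinuousLinearMap.toLinearMap_smul, ContinuousLinearMap.coe_id]
      exact LinearMap.IsSymmetric.id.smul (by simp)
    rw [hA, ContinuousLinearMap.toLinearMap_add]
    exact h1.add hDVsym
  have hn : Module.finrank ℝ (EuclideanSpace ℝ (Fin 3)) = 3 := finrank_euclideanSpace_fin
  set e := hAsym.eigenvectorBasis hn with he
  set ev : Fin 3 → ℝ := hAsym.eigenvalues hn with hev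
  have hAe : ∀ i, A (e i) = ev i • e i := fun i => hAsym.apply_eigenvectorBasis hn i
  -- Rayleigh quotient: `⟪A v, v⟫ = Σ ev i ⟪e i, v⟫²`, `‖v‖² = Σ ⟪e i, v⟫²`
  have hnormsq : ∀ v : EuclideanSpace ℝ (Fin 3), ‖v‖ ^ 2 = ∑ i, ⟪e i, v⟫ * ⟪e i, v⟫ := by
    intro v
    rw [← real_inner_self_eq_norm_sq, ← e.sum_inner_mul_inner v v]
    exact Finset.sum_congr rfl fun i _ => by rw [real_inner_comm]
  have hquad : ∀ v : EuclideanSpace ℝ (Fin 3), ⟪A v, v⟫ = ∑ i, ev i * (⟪e i, v⟫ * ⟪e i, v⟫) := by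
    intro v
    rw [← e.sum_inner_mul_inner (A v) v]
    refine Finset.sum_congr rfl fun i _ => ?_
    have hsym := hAsym (e i) v
    simp only [ContinuousLinearMap.coe_coe] at hsym
    rw [real_inner_comm (e i) (A v), ← hsym, hAe, real_inner_smul_left]
    ring
  -- trace: `Σ ev i = 3γ`
  have htr : ev 0 + ev 1 + ev 2 = 3 * γ :=
    sum_blockDiag_eq_three_mul (γ := γ) hdiv z e.toBasis ev 0 (by simpa [hA] using hAe 0)
      (by simpa [hA] using hAe 1) (by simpa [hA] using hAe 2)
  -- the maximal eigenvalue is `≥ 1 + γ`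
  obtain ⟨i₃, -, hi₃⟩ := Finset.exists_max_image Finset.univ ev Finset.univ_nonempty
  have hmax : 1 + γ ≤ ev i₃ := by
    obtain ⟨w, hw1, hw⟩ := hbad
    have hAw : ⟪A w, w⟫ = γ + ⟪fderiv ℝ V z w, w⟫ := by
      rw [hA, add_apply, smul_apply, ContinuousLinearMap.id_apply, inner_add_left, real_inner_smul_left,
        real_inner_self_eq_norm_sq, hw1]
      ring
    have h1 : ⟪A w, w⟫ ≤ ev i₃ * ‖w‖ ^ 2 := by
      rw [hquad, hnormsq, Finset.mul_sum]
      exact Finset.sum_le_sum fun i _ => mul_le_mul_of_nonneg_right (hi₃ i (Finset.mem_univ i)) (mul_self_nonneg _)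
    rw [hw1, one_pow, mul_one, hAw] at h1
    linarith
  -- the minimal eigenvalue among the other two
  have hne : (Finset.univ.erase i₃ : Finset (Fin 3)).Nonempty := by
    rw [← Finset.card_pos, Finset.card_erase_of_mem (Finset.mem_univ _), Finset.card_univ, Fintype.card_fin]
    norm_num
  obtain ⟨j₀, hj₀, hj₀min⟩ := Finset.exists_min_image _ ev hne
  have hj₀ne : j₀ ≠ i₃ := (Finset.mem_erase.1 hj₀).1
  have hne' : ((Finset.univ.erase i₃).erase j₀ : Finset (Fin 3)).Nonempty := by
    rw [← Finset.card_pos, Finset.card_erase_of_mem hj₀, Finset.card_erase_of_mem (Finset.mem_univ _),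
      Finset.card_univ, Fintype.card_fin]
    norm_num
  obtain ⟨k, hk⟩ := hne'
  have hkj : k ≠ j₀ := (Finset.mem_erase.1 hk).1
  have hki : k ≠ i₃ := (Finset.mem_erase.1 (Finset.mem_erase.1 hk).2).1
  have hjk : ev j₀ ≤ ev k := hj₀min k (Finset.mem_erase.1 hk).2
  -- `ev j₀ + ev k = 3γ − ev i₃ ≤ 2γ − 1 < 0`
  have hsum3 : ev i₃ + ev j₀ + ev k = 3 * γ := by
    -- `Σ_univ = ev i₃ + (ev j₀ + Σ over the remaining singleton {k})`
    have hrest : ((Finset.univ.erase i₃).erase j₀ : Finset (Fin 3)) = {k} := by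
      have hcard : ((Finset.univ.erase i₃).erase j₀ : Finset (Fin 3)).card = 1 := by
        rw [Finset.card_erase_of_mem hj₀, Finset.card_erase_of_mem (Finset.mem_univ _), Finset.card_univ,
          Fintype.card_fin]
      obtain ⟨a, ha⟩ := Finset.card_eq_one.1 hcard
      rw [ha] at hk ⊢
      rw [Finset.mem_singleton.1 hk]
    have h1 := Finset.add_sum_erase Finset.univ ev (Finset.mem_univ i₃)
    have h2 := Finset.add_sum_erase (Finset.univ.erase i₃) ev hj₀
    rw [hrest, Finset.sum_singleton] at h2
    rw [← h2, Fin.sum_univ_three] at h1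
    linarith
  have hj₀neg : ev j₀ < 0 := by linarith
  -- the basis `(e k, e i₃, e j₀)` resp. `(e j₀, e k, e i₃)`
  rcases lt_or_eq_of_le hjk with hlt | heq
  · -- dominated contracting line `e j₀`
    set v : Fin 3 → EuclideanSpace ℝ (Fin 3) := ![e k, e i₃, e j₀] with hv
    have hli : LinearIndependent ℝ v := linearIndependent_orthonormalBasis_triple e hki hkj hj₀ne.symm
    set b' := basisOfLinearIndependentOfCardEqFinrank hli (by simp [hn]) with hb'
    have hb'v : ∀ a, b' a = v a := fun a => by rw [hb', coe_basisOfLinearIndependentOfCardEqFinrank]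
    refine ⟨b', ![ev k, ev i₃, ev j₀], 0, ?_, ?_, ?_, Or.inl ⟨?_, ?_, ?_⟩⟩
    · rw [hb'v, hb'v]; simp [hv, hAe]
    · rw [hb'v, hb'v]; simp [hv, hAe]
    · rw [hb'v]; simp [hv, hAe]
    · simpa using hj₀neg
    · simpa using hlt
    · simp only [Matrix.cons_val]
      linarith
  · -- dominated contracting plane `span{e j₀, e k}` (`ev j₀ = ev k < 0 < ev i₃`)
    set v : Fin 3 → EuclideanSpace ℝ (Fin 3) := ![e j₀, e k, e i₃] with hv
    have hli : LinearIndependent ℝ v := linearIndependent_orthonormalBasis_triple e hkj.symm hj₀ne hki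
    set b' := basisOfLinearIndependentOfCardEqFinrank hli (by simp [hn]) with hb'
    have hb'v : ∀ a, b' a = v a := fun a => by rw [hb', coe_basisOfLinearIndependentOfCardEqFinrank]
    refine ⟨b', ![ev j₀, ev k, ev i₃], 0, ?_, ?_, ?_, Or.inr ⟨?_, ?_, ?_, ?_⟩⟩
    · rw [hb'v, hb'v]; simp [hv, hAe]
    · rw [hb'v, hb'v]; simp [hv, hAe]
    · rw [hb'v]; simp [hv, hAe]
    · simpa using hj₀neg
    · simp only [Matrix.cons_val]; linarith
    · simp only [Matrix.cons_val]; linarith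
    · simp only [Matrix.cons_val]; linarith

/-! ### The exclusion theorem with block data only at vortical bad nodes -/

/-- **EXCLUSION — block hypothesis only at VORTICAL bad nodes.**  `0 < γ < ½`, `V` smooth with (3.8); a `C¹` drift
coordinate on an open `U ⊇ 𝒩_W` injective on `𝒩_W`; a thin real block form (either shape) at every bad node with
`curl V z ≠ 0`.  Then `V ≡ 0` (non-vortical bad nodes are thin automatically). [cite: ConstantinIgnatovaVicol2026Putative, §3.5 Thms 3.8/3.10 (strengthened); Robinson1999, Ch. V §5.10.1] -/
theorem eq_zero_of_driftCoordinate_of_thinBlock_on_vorticalBadSet (hV : ContDiff ℝ ∞ V)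
    (hprof : IsSelfSimilarEulerProfile γ 0 V P) (hγ : 0 < γ) (hγ2 : γ < 1 / 2)
    {C₀ : ℝ} (hfar : HasSelfSimilarFarFieldWith γ 0 C₀ V)
    (hblock : ∀ z ∈ selfSimilarNodalSet γ 0 V, curl V z ≠ 0 →
      (∃ w : EuclideanSpace ℝ (Fin 3), ‖w‖ = 1 ∧ 1 ≤ ⟪fderiv ℝ V z w, w⟫) →
      ∃ (b : Module.Basis (Fin 3) ℝ (EuclideanSpace ℝ (Fin 3))) (lam : Fin 3 → ℝ) (β : ℝ),
        (γ • ContinuousLinearMap.id ℝ (EuclideanSpace ℝ (Fin 3)) + fderiv ℝ V z) (b 0) = lam 0 • b 0 - β • b 1 ∧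
        (γ • ContinuousLinearMap.id ℝ (EuclideanSpace ℝ (Fin 3)) + fderiv ℝ V z) (b 1) = β • b 0 + lam 1 • b 1 ∧
        (γ • ContinuousLinearMap.id ℝ (EuclideanSpace ℝ (Fin 3)) + fderiv ℝ V z) (b 2) = lam 2 • b 2 ∧
        ((lam 2 < 0 ∧ lam 2 < lam 0 ∧ lam 2 < lam 1) ∨ (lam 0 < 0 ∧ lam 1 < 0 ∧ lam 0 < lam 2 ∧ lam 1 < lam 2)))
    {U : Set (EuclideanSpace ℝ (Fin 3))} (hU : IsOpen U) (hNU : selfSimilarNodalSet γ 0 V ⊆ U)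
    {F' : Type*} [NormedAddCommGroup F'] [NormedSpace ℝ F'] [CompleteSpace F']
    {f : EuclideanSpace ℝ (Fin 3) → F'} (hf : ContDiff ℝ 1 f) {C : ℝ}
    (hdrift : ∀ y ∈ U, ‖fderiv ℝ f y (selfSimilarTransport γ 0 V y)‖ ≤ C * ‖selfSimilarTransport γ 0 V y‖ ^ 2)
    (hinj : InjOn f (selfSimilarNodalSet γ 0 V)) :
    V = 0 := by
  refine eq_zero_of_driftCoordinate_of_thinBlock_on_badSet hV hprof hγ hγ2 hfar (fun z hz hbad => ?_)
    hU hNU hf hdrift hinj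
  by_cases hcurl : curl V z = 0
  · exact exists_thinBlock_of_curl_eq_zero_of_bad (hV.differentiable (by simp)) hprof.divFree hγ2 hcurl hbad
  · exact hblock z hz hcurl hbad

/-- **If every bad stagnation point is non-vortical, a drift coordinate alone forces triviality.**  `0 < γ < ½`, `V`
smooth with (3.8); `curl V = 0` at every bad node; a `C¹` drift coordinate on an open `U ⊇ 𝒩_W` injective on `𝒩_W`
⇒ `V ≡ 0`. [cite: ConstantinIgnatovaVicol2026Putative, §3.5 Thms 3.8/3.10 (strengthened); Robinson1999, Ch. V §5.10.1] -/
theorem eq_zero_of_driftCoordinate_of_nonvortical_badNodes (hV : ContDiff ℝ ∞ V)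
    (hprof : IsSelfSimilarEulerProfile γ 0 V P) (hγ : 0 < γ) (hγ2 : γ < 1 / 2)
    {C₀ : ℝ} (hfar : HasSelfSimilarFarFieldWith γ 0 C₀ V)
    (hnonvort : ∀ z ∈ selfSimilarNodalSet γ 0 V,
      (∃ w : EuclideanSpace ℝ (Fin 3), ‖w‖ = 1 ∧ 1 ≤ ⟪fderiv ℝ V z w, w⟫) → curl V z = 0)
    {U : Set (EuclideanSpace ℝ (Fin 3))} (hU : IsOpen U) (hNU : selfSimilarNodalSet γ 0 V ⊆ U)
    {F' : Type*} [NormedAddCommGroup F'] [NormedSpace ℝ F'] [CompleteSpace F']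
    {f : EuclideanSpace ℝ (Fin 3) → F'} (hf : ContDiff ℝ 1 f) {C : ℝ}
    (hdrift : ∀ y ∈ U, ‖fderiv ℝ f y (selfSimilarTransport γ 0 V y)‖ ≤ C * ‖selfSimilarTransport γ 0 V y‖ ^ 2)
    (hinj : InjOn f (selfSimilarNodalSet γ 0 V)) :
    V = 0 :=
  eq_zero_of_driftCoordinate_of_thinBlock_on_vorticalBadSet hV hprof hγ hγ2 hfar
    (fun z hz hcurl hbad => absurd (hnonvort z hz hbad) hcurl) hU hNU hf hdrift hinj

end Summit.NavierStokesRegularity.NavierStokesRegularity.Theorems.PowerGaugeEulerLiouville.Kelvin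

end
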